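import Mathlib
import Literature.Analysis.FluidPDE.AxisymmetricEuler
import Literature.Analysis.FluidPDE.PineauVicolAngularMean
import Literature.Analysis.FluidPDE.OctahedralSymmetry
import Summits.NavierStokesRegularity.NavierStokesRegularity.Theorems.ScenarioCensusForward
import Summits.NavierStokesRegularity.NavierStokesRegularity.Theorems.ScenarioCensusAncientAnnex
import HarnessLib.Audit
import HarnessLib

/-!
# Blow-up scenario census — block F annex (cone-free): row F13m, forward Clay data with an `m`-fold
# rotational symmetry (finite symmetry group, regularity side)

Cell `pub/ns-census` (`SCENARIO-CENSUS.md` v1.27, seat ns-census-lead g4; ORDER 09:44Z 3–4/4, key F13m).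
Row F13 of the census (forward · finite reflection/rotation group · Leray–Hopf classical) is OPEN-NO-LINE
on the regularity side: "no FORWARD-side theorem uses a finite symmetry group to exclude blow-up (the
class is flow-invariant, so the cell is F0 restricted)"; on the ANCIENT Type-I side large cyclic orders ARE
excluded (row A9′, `Row_A9p`, ineffective threshold) and the effective order meter is row A9e
(`Row_A9e`, `ScenarioCensusAncientAnnex.lean`).  This file types the FORWARD analogue for the cyclic
groups `C_m = ⟨R_{2π/m}⟩` about the fixed axis `e₃` (census §5 #5: "the forward/ancient analogues of those
`rdssClass_*` symmetry exclusions are the natural untried cells"):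

* `Row_F13m m` — row F0 (`Row_F0`, `ScenarioCensusForward.lean`: every classical Leray–Hopf solution on
  `ℝ³ × [0,T)` from a rapidly decaying datum extends past `T`) RESTRICTED to data with
  `u₀ ∘ R_{2π/m} = R_{2π/m} ∘ u₀` (`FluidPDE.rotZ`).  OPEN (`@[conjecture]`) for every `m`; `m = 0, 1`
  give back F0 itself (`R_{2π/0} = R_0 = id` in Lean, `R_{2π} = id`).
* `Row_F13mLarge` — the LARGE-ORDER form `∃ m₀, ∀ m ≥ m₀, Row_F13m m` (forward analogue of A9′).
* glue `row_F13m_of_row_F0 : Row_F0 → Row_F13m m` (the symmetry hypothesis is carried, not used),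
  `row_F13mLarge_of_row_F0`, `row_F13mLarge_of_forall`, and the monotonicity-free remark
  `row_F13m_zero_iff_row_F0` (at `m = 0` the hypothesis is vacuous).

Cone-free: imports `ScenarioCensusForward` (→ `Theorems.LiouvilleConjectureNS`,
`Theorems.AxisymmetricSwirlRegularity`, Literature), no Theses module.  No summit statement is proved
here; nothing in this file is a claim about NS regularity.
-/

noncomputable section

-- the summit and its single problem share the name `NavierStokesRegularity` (D-0017 nested layout)
set_option linter.dupNamespace false

open Set Function Filter Topology MeasureTheory Metric
open scoped NNReal ENNReal

namespace Summit.NavierStokesRegularity.NavierStokesRegularity.Theorems.ScenarioCensus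

open Literature.Analysis Literature.Analysis.FluidPDE

/-- **Row F13m** (I∨II · forward · `m`-fold rotational symmetry of the DATUM about `e₃`,
`u₀ (R_{2π/m} x) = R_{2π/m} (u₀ x)` · Clay class: classical Leray–Hopf solution on `ℝ³ × [0,T)` from a
rapidly decaying datum): the solution extends past `T`.  Row F0 restricted to `C_m`-symmetric data (the
class is flow-invariant by uniqueness, so this is a genuine sub-cell of F0); forward analogue of rows
A9′/A9e.  OPEN for every `m ≥ 2` — nothing asserted (`m = 0, 1`: the hypothesis is vacuous, the row is F0).
[cite: KochNadirashviliSereginSverak2009, §1 (arXiv:0709.3599)] -/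
@[conjecture] def Row_F13m (m : ℕ) : Prop :=
  ∀ (ν T : ℝ), 0 < ν → 0 < T →
    ∀ (u : ℝ → EuclideanSpace ℝ (Fin 3) → EuclideanSpace ℝ (Fin 3))
      (p : ℝ → EuclideanSpace ℝ (Fin 3) → ℝ),
    IsClassicalNSSolutionOn (Ico 0 T) ν 0 u p → IsLerayHopfOn T ν 0 (u 0) u →
    HasRapidSpatialDecay (u 0) →
    (∀ x : EuclideanSpace ℝ (Fin 3), u 0 (rotZ (2 * Real.pi / m) x) = rotZ (2 * Real.pi / m) (u 0 x)) →
      HasSmoothExtensionPast ν 0 u T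

/-- **Row F13mLarge** (the LARGE-ORDER forward cell): there is an order `m₀` such that row F13m holds for
every `m ≥ m₀` — the forward analogue of row A9′ (`Row_A9p`: large-order cyclic symmetry kills Type-I
ANCIENT solutions, ineffective `m₀`).  OPEN — nothing asserted.
[cite: KochNadirashviliSereginSverak2009, §1 (arXiv:0709.3599)] -/
@[conjecture] def Row_F13mLarge : Prop :=
  ∃ m₀ : ℕ, ∀ m : ℕ, m₀ ≤ m → Row_F13m m

/-- **F0 ⇒ F13m**: the symmetric cell is a sub-cell of row F0 (the symmetry hypothesis is carried, not
used). [folklore] -/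
theorem row_F13m_of_row_F0 (h0 : Row_F0) (m : ℕ) : Row_F13m m :=
  fun ν T hν hT u p hcl hLH hdec _ => h0 ν T hν hT u p hcl hLH hdec

/-- **F0 ⇒ F13mLarge** (with `m₀ = 0`). [folklore] -/
theorem row_F13mLarge_of_row_F0 (h0 : Row_F0) : Row_F13mLarge :=
  ⟨0, fun m _ => row_F13m_of_row_F0 h0 m⟩

/-- All orders ⇒ the large-order cell. [folklore] -/
theorem row_F13mLarge_of_forall (h : ∀ m : ℕ, Row_F13m m) : Row_F13mLarge :=
  ⟨0, fun m _ => h m⟩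

/-- At `m = 0` the symmetry hypothesis is vacuous (`2π/0 = 0` and `R_0 = id`), so `Row_F13m 0` IS row F0:
the honest reading of the family at the degenerate index. [folklore] -/
theorem row_F13m_zero_iff_row_F0 : Row_F13m 0 ↔ Row_F0 := by
  constructor
  · intro h ν T hν hT u p hcl hLH hdec
    refine h ν T hν hT u p hcl hLH hdec fun x => ?_
    simp [FluidPDE.rotZ_zero]
  · intro h0
    exact row_F13m_of_row_F0 h0 0

/-! ## Appended 2026-08-28 (typer-1 g4, lead g4 ORDER 11:10Z): the census ALGEBRA of the net `Row_F13m m`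
## — VERBATIM from ideator ns-idea-9 g4, LINE 10 «axis_split» rev 3 addendum
## `pub/ideators/ns-idea-9/lines/axis_split/axis_split_census.lean` (credit: ns-idea-9; re-homed into the
## census namespace; `ℝ³` spelled out, `rotZ_two_pi_eq` replaced by `FluidPDE.rotZ_two_pi`, the duplicate
## `row_F13m_zero_iff_row_F0` omitted — it is already above)

* `row_F0_of_row_F13m_one`, `row_F13m_one_iff_row_F0`, `row_F0_of_row_F13m_zero` — at the orders `m = 1`,
  `m = 0` the symmetry hypothesis is VACUOUS (`R_{2π} = R_0 = id`; in Lean `2π/0 = 0`), so these rows ARE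
  row F0 (kernel `iff`);
* `row_F13m_mul` — DIVISIBILITY MONOTONICITY: `Row_F13m m → Row_F13m (k m)` for `k ≠ 0`;
* `forall_row_F13m_iff_row_F0`, `row_F13m_one_iff_forall` — the WHOLE net is equivalent to row F0; only its
  cofinal TAIL `Row_F13mLarge` is a candidate for a statement strictly weaker than F0.
No row and no census value is proved: implications / equivalences between OPEN rows only. -/

/-- The symmetry hypothesis of row F13m at order `1` is vacuous. [folklore] -/
theorem cm_symmetric_one (v : (EuclideanSpace ℝ (Fin 3)) → (EuclideanSpace ℝ (Fin 3))) (x : (EuclideanSpace ℝ (Fin 3))) :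
    v (rotZ (2 * Real.pi / ((1 : ℕ) : ℝ)) x) = rotZ (2 * Real.pi / ((1 : ℕ) : ℝ)) (v x) := by
  simp [FluidPDE.rotZ_two_pi]

/-- The symmetry hypothesis of row F13m at order `0` is vacuous (`2π/0 = 0` in Lean). [folklore] -/
theorem cm_symmetric_zero (v : (EuclideanSpace ℝ (Fin 3)) → (EuclideanSpace ℝ (Fin 3))) (x : (EuclideanSpace ℝ (Fin 3))) :
    v (rotZ (2 * Real.pi / ((0 : ℕ) : ℝ)) x) = rotZ (2 * Real.pi / ((0 : ℕ) : ℝ)) (v x) := by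
  simp

/-- **F13m at order 1 ⇒ F0.** [folklore] -/
theorem row_F0_of_row_F13m_one (h : Row_F13m 1) : Row_F0 :=
  fun ν T hν hT u p hcl hLH hdec => h ν T hν hT u p hcl hLH hdec (cm_symmetric_one (u 0))

/-- **F13m at order 0 ⇒ F0.** [folklore] -/
theorem row_F0_of_row_F13m_zero (h : Row_F13m 0) : Row_F0 :=
  fun ν T hν hT u p hcl hLH hdec => h ν T hν hT u p hcl hLH hdec (cm_symmetric_zero (u 0))

/-- **Row F13m at order 1 IS row F0** (kernel `iff`). [folklore] -/
theorem row_F13m_one_iff_row_F0 : Row_F13m 1 ↔ Row_F0 :=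
  ⟨row_F0_of_row_F13m_one, fun h0 => row_F13m_of_row_F0 h0 1⟩

/-- Iterating an exact equivariance `k` times. [folklore] -/
theorem cm_symmetric_nat_mul {v : (EuclideanSpace ℝ (Fin 3)) → (EuclideanSpace ℝ (Fin 3))} {a : ℝ} (hv : ∀ x, v (rotZ a x) = rotZ a (v x))
    (k : ℕ) (x : (EuclideanSpace ℝ (Fin 3))) : v (rotZ (k * a) x) = rotZ (k * a) (v x) := by
  induction k generalizing x with
  | zero => simp
  | succ k ih =>
    have h : ((k + 1 : ℕ) : ℝ) * a = a + k * a := by push_cast; ring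
    rw [h, rotZ_add, hv, ih, ← rotZ_add]

/-- **Divisibility monotonicity of the net**: `Row_F13m m → Row_F13m (k m)` for `k ≠ 0`
(a `C_{km}`-symmetric datum is `C_m`-symmetric). [folklore] -/
theorem row_F13m_mul {m : ℕ} (h : Row_F13m m) {k : ℕ} (hk : k ≠ 0) : Row_F13m (k * m) := by
  intro ν T hν hT u p hcl hLH hdec hsym
  refine h ν T hν hT u p hcl hLH hdec fun x => ?_
  have hk' : (k : ℝ) ≠ 0 := Nat.cast_ne_zero.2 hk
  have hang : (k : ℝ) * (2 * Real.pi / ((k * m : ℕ) : ℝ)) = 2 * Real.pi / m := by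
    rw [Nat.cast_mul, ← mul_div_assoc, mul_div_mul_left _ _ hk']
  have := cm_symmetric_nat_mul hsym k x
  rwa [hang] at this

/-- Order `1` gives every order. [folklore] -/
theorem row_F13m_of_one (h : Row_F13m 1) (m : ℕ) : Row_F13m m :=
  row_F13m_of_row_F0 (row_F0_of_row_F13m_one h) m

/-- **The whole net is row F0.** [folklore] -/
theorem forall_row_F13m_iff_row_F0 : (∀ m : ℕ, Row_F13m m) ↔ Row_F0 :=
  ⟨fun h => row_F0_of_row_F13m_one (h 1), fun h0 m => row_F13m_of_row_F0 h0 m⟩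

/-- Order `1` alone is the whole net. [folklore] -/
theorem row_F13m_one_iff_forall : Row_F13m 1 ↔ ∀ m : ℕ, Row_F13m m :=
  ⟨row_F13m_of_one, fun h => h 1⟩

/-- A single order controls its multiples: `Row_F13m m → ∀ k ≠ 0, Row_F13m (k m)`; in particular
`Row_F13m 2` gives every EVEN order — but no single order `m ≥ 2` is known to give the cofinal tail
`Row_F13mLarge` (all large orders), which is the object LINE 10 attacks. [folklore] -/
theorem row_F13m_multiples {m : ℕ} (h : Row_F13m m) : ∀ k : ℕ, k ≠ 0 → Row_F13m (k * m) :=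
  fun _ hk => row_F13m_mul h hk

/-! ## Appended 2026-08-28 (typer-1 g4, lead g5 ORDER 11:31Z): row F13o — the octahedral Type-I window
## (forward; ideator ns-idea-2 «platonic-window» rev 7, `line-platonic-window.lean` :726, VERBATIM)

Row F13o = row F1 ∩ row F13 at `G = O_h` ∩ the space window `‖x‖ ‖u(t,x)‖ ≤ A ν`, `A ≤ 9/2`: the FORWARD
counterpart of row A9o (the line's composition is `Row_A9o ∧ OhTypeIZoom ⇒ Row_F13o`; neither typed here).
`IsOhEquivariant` = `Literature.Analysis.FluidPDE.IsOhEquivariant` (`OctahedralSymmetry.lean`),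
`IsTypeIBlowup` = the Type-I rate predicate of row F1 (`SuitableWeak.lean`). -/

/-- **Row F13o** («octahedral Type-I window», FORWARD / Clay class): a classical Leray–Hopf solution on
`ℝ³ × [0,T)` from a rapidly decaying `O_h`-equivariant datum, with the Type-I rate at `T` (`IsTypeIBlowup u T`)
and `‖x‖ ‖u(t,x)‖ ≤ A ν` for all `t ∈ [0,T)`, `x`, where `A ≤ 9/2`, extends smoothly past `T`.  VERBATIM
`Row_F13o` of the platonic-window line rev 7 (:726).  Sub-cell of row F1 (`row_F13o_of_row_F1`: rate carried,
symmetry and window unused) and of row F0.  OPEN — nothing asserted.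
[cite: KochNadirashviliSereginSverak2009, §1 conjecture (L) and §6 Prop. 6.1 (arXiv:0709.3599)] -/
@[conjecture] def Row_F13o : Prop :=
  ∀ (ν T A : ℝ), 0 < ν → 0 < T → A ≤ 9 / 2 →
    ∀ (u : ℝ → EuclideanSpace ℝ (Fin 3) → EuclideanSpace ℝ (Fin 3))
      (p : ℝ → EuclideanSpace ℝ (Fin 3) → ℝ),
    IsClassicalNSSolutionOn (Ico 0 T) ν 0 u p → IsLerayHopfOn T ν 0 (u 0) u →
    HasRapidSpatialDecay (u 0) → IsTypeIBlowup u T → IsOhEquivariant (u 0) →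
    (∀ t ∈ Ico 0 T, ∀ x, ‖x‖ * ‖u t x‖ ≤ A * ν) →
      HasSmoothExtensionPast ν 0 u T

/-- **F1 ⇒ F13o**: the octahedral Type-I window is a sub-cell of row F1 (Type I, no symmetry): the rate is
carried, the symmetry and the window are not used. [folklore] -/
theorem row_F13o_of_row_F1 (h1 : Row_F1) : Row_F13o :=
  fun ν T _ hν hT _ u p hcl hLH hdec hI _ _ => h1 ν T hν hT u p hcl hLH hdec hI

/-- **F0 ⇒ F13o** (through `row_F1_of_F0`: F1 is a sub-cell of F0). [folklore] -/
theorem row_F13o_of_row_F0 (h0 : Row_F0) : Row_F13o :=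
  row_F13o_of_row_F1 (row_F1_of_F0 h0)

/-! ## Appended 2026-08-28 (typer-1 g4, lead g5 NOTE 11:37Z (i)): row F13i — the irreducible-symmetry Type-I window
## (forward; ideator ns-idea-2 «platonic-window» rev 7, `line-platonic-window.lean` :797, VERBATIM;
## `IsIrreducibleSet` = the census decl of `ScenarioCensusAncientAnnex.lean`, cone-free import) -/

/-- **Row F13i** («irreducible-symmetry Type-I window», FORWARD / Clay class; = row F1 ∩ {datum equivariant
under an irreducibly acting set `G` of linear isometries, `IsIrreducibleSet G`} ∩ space window
`‖x‖ ‖u(t,x)‖ ≤ A ν`, `A ≤ 5/2`): the solution extends past `T`.  VERBATIM `Row_F13i` of the platonic-window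
line rev 7 (:797); `G` need not be finite or a group (every irreducible finite symmetry class T, T_d, T_h, O,
O_h, I, I_h is an instance).  Forward counterpart of row A9i (the line: `Row_A9i ∧ SymTypeIZoom ⇒ Row_F13i`,
not typed here).  Sub-cell of row F1 (`row_F13i_of_row_F1`).  OPEN — nothing asserted.
[cite: KochNadirashviliSereginSverak2009, §1 conjecture (L) and §6 Prop. 6.1 (arXiv:0709.3599)] -/
@[conjecture] def Row_F13i : Prop :=
  ∀ (ν T A : ℝ) (G : Set (EuclideanSpace ℝ (Fin 3) ≃ₗᵢ[ℝ] EuclideanSpace ℝ (Fin 3))),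
    IsIrreducibleSet G → 0 < ν → 0 < T → A ≤ 5 / 2 →
    ∀ (u : ℝ → EuclideanSpace ℝ (Fin 3) → EuclideanSpace ℝ (Fin 3))
      (p : ℝ → EuclideanSpace ℝ (Fin 3) → ℝ),
    IsClassicalNSSolutionOn (Ico 0 T) ν 0 u p → IsLerayHopfOn T ν 0 (u 0) u →
    HasRapidSpatialDecay (u 0) → IsTypeIBlowup u T → (∀ g ∈ G, ∀ x, u 0 (g x) = g (u 0 x)) →
    (∀ t ∈ Ico 0 T, ∀ x, ‖x‖ * ‖u t x‖ ≤ A * ν) →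
      HasSmoothExtensionPast ν 0 u T

/-- **F1 ⇒ F13i** (platonic-window :818, ON PATH): row F1 contains the cell F13i — rate carried, symmetry and
window unused. [folklore] -/
theorem row_F13i_of_row_F1 (h : Row_F1) : Row_F13i :=
  fun ν T _ _ _ hν hT _ u p hcl hLH hdec hI _ _ => h ν T hν hT u p hcl hLH hdec hI

/-- **F0 ⇒ F13i** (through `row_F1_of_F0`). [folklore] -/
theorem row_F13i_of_row_F0 (h0 : Row_F0) : Row_F13i :=
  row_F13i_of_row_F1 (row_F1_of_F0 h0)

end Summit.NavierStokesRegularity.NavierStokesRegularity.Theorems.ScenarioCensus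

end
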